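import Summits.ValiantsHypothesis.ValiantsHypothesis.Theorems.KPlusLogSqLawTropicalBMultiRunDeficit
import Summits.ValiantsHypothesis.ValiantsHypothesis.Theorems.KPlusLogSqLawTropicalBContactStretch

/-!
# Route «KPlusLogSqLaw», crux `TropicalB` (stmt-ValiantsHypothesis-19771) — THE THREE-CONTACT LAW: three single-token activations over a
# common base deviate at a common column (no free triangle)

HONEST FRAMING.  Helper toward the registered stubs `stub_tropThin` / `stub_tropFat` of `Cruxes/TropicalB/Lines/birth.lean` (crux
`Summit.ValiantsHypothesis.ValiantsHypothesis.Theses.KPlusLogSqLaw.TropicalB`, item stmt-ValiantsHypothesis-19771, route KPlusLogSqLaw;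
cell `pub-symmetroid`, seat val-sym-trop-p5 g26, refuter-adjacent lane, 2026-08-29; `--supports … --as helper`).  A STRUCTURE law about
unique optima (`IsDominant`) of an ARBITRARY dominance design; nothing here bounds `TropicalB`, and nothing bears on `WeakLifting`,
DoorA26 / DoorA34, `MatrixDescartes` (stmt-ValiantsHypothesis-18050) or VP ≠ VNP.

THE LAW (`three_contact`).  `B`, `P`, `Q`, `R` unique optima of one design (at `θB`, `θP`, `θQ`, `θR`), `P`, `Q`, `R` SINGLE-TOKEN
ACTIVATIONS over `B` (classes = those of `B` off one column each, where the exponent goes up; e.g. `M_S`, `M_{S+x}`, `M_{S+y}`, `M_{S+z}`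
in a radix-2 odometer).  THEN SOME COLUMN DEVIATES FROM `B` IN ALL THREE: the three exchange cycles have a common column.  (Line 4 of memo
HOME/val-sym-trop-p5/g25/CONTACT-LAWS-g25.md — «three activation cycles over a common state never have pairwise disjoint contacts», there on
paper modulo C2; located HOME/val-sym-trop-p5/g26/exp/hub_check.py: 89/89 concentrated triples on the cell's seven cube chains.)  The
HUB LAW proper (ALL concentrated activations over a state share a column; located 43/43 states) needs in addition a Helly step on the
cycle and is NOT claimed here.

PROOF (free triangle).  Suppose no common column.  The three pairwise contacts are nonempty and each has a triple column `cPQ`, `cQR`, `cRP`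
(`exists_triple`, …TropicalBContactStretch).  Walk `P`'s cycle from `cRP` to its first common column with `Q`: the ENTRY column `uQ` of
the `PQ`-contact; walk `Q`'s cycle from `uQ` to the entry `uR` of the `QR`-contact, `R`'s cycle from `uR` to the entry `uP` of the
`RP`-contact, and `P`'s cycle from `uP` to the `PQ`-contact again — arriving at `uQ` (`entry_unique`).  The three first runs
`[uP,uQ)_P`, `[uQ,uR)_Q`, `[uR,uP)_R` avoid the next cycle (`first_hit`) and dock in the order `P → Q → R → P`; the complementary runs
`[uQ,uP)_P`, `[uR,uQ)_Q`, `[uP,uR)_R` avoid the previous cycle (`tail_avoids`) and dock in the order `P → R → Q → P`.  `multiRun_deficit`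
(…TropicalBMultiRunDeficit, index type `Fin 3`, witnesses the triple columns) bounds the token gains held by each docking by its run
valuations; adding the two, each activation's valuation gain (summed over its whole cycle, `cycle_total`, split by `pieceFun_add`) appears
on both sides — contradiction.

[this cell; folklore ingredients (exchange cycles, lower hulls)]
-/

set_option linter.dupNamespace false
set_option autoImplicit false

namespace Summit.ValiantsHypothesis.ValiantsHypothesis.Theorems.KPlusLogSqLaw

namespace SingleContact

/-! ## 10. THE THREE-CONTACT LAW -/

section Three

open Summit.ValiantsHypothesis.ValiantsHypothesis.Theorems.MatrixDescartes.Negative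
open Summit.ValiantsHypothesis.ValiantsHypothesis.Theorems.LacunarySymmetroidMatrixDescartes
open Finset

variable {m K : ℕ} (d : Fin K → ℕ) (v ε : Fin m → Fin m → Fin K → ℤ)

/-- **THE THREE-CONTACT LAW.**  `B`, `P`, `Q`, `R` unique optima of one design, `P`, `Q`, `R` SINGLE-TOKEN ACTIVATIONS over `B` (classes
= those of `B` off one column each, where the exponent goes up).  Then some column deviates from `B` in all three of `P`, `Q`, `R`: the
three exchange cycles have a common column.  Proof: otherwise the three pairwise contacts are disjoint stretches; docking the three cycles
at the ENTRY columns of the stretches in the cyclic order `P → Q → R → P` (runs from each entry column to the next, `first_hit`) and in the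
order `P → R → Q → P` (the complementary runs, which avoid the contacts by `tail_avoids`) gives two present terms (`multiRun_deficit` twice)
whose valuation gains add up to the three activation gains counted once with each sign — a free triangle, impossible. [this cell] -/
theorem three_contact {θB θP θQ θR : ℤ} {B P Q R : Equiv.Perm (Fin m) × (Fin m → Fin K)}
    (hB : IsDominant d v ε θB B) (hP : IsDominant d v ε θP P) (hQ : IsDominant d v ε θQ Q) (hR : IsDominant d v ε θR R)
    (eP eQ eR : Fin m)
    (hcP : ∀ i, i ≠ eP → d (P.2 i) = d (B.2 i)) (hcQ : ∀ i, i ≠ eQ → d (Q.2 i) = d (B.2 i))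
    (hcR : ∀ i, i ≠ eR → d (R.2 i) = d (B.2 i))
    (hδP : d (B.2 eP) < d (P.2 eP)) (hδQ : d (B.2 eQ) < d (Q.2 eQ)) (hδR : d (B.2 eR) < d (R.2 eR)) :
    ∃ c, ¬ (P.1 c = B.1 c ∧ P.2 c = B.2 c) ∧ ¬ (Q.1 c = B.1 c ∧ Q.2 c = B.2 c) ∧ ¬ (R.1 c = B.1 c ∧ R.2 c = B.2 c) := by
  classical
  by_contra H'
  have H : ∀ c, ¬ (¬ (P.1 c = B.1 c ∧ P.2 c = B.2 c) ∧ ¬ (Q.1 c = B.1 c ∧ Q.2 c = B.2 c) ∧ ¬ (R.1 c = B.1 c ∧ R.2 c = B.2 c)) :=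
    fun c hc => H' ⟨c, hc⟩
  have HQ : ∀ c, ¬ (¬ (Q.1 c = B.1 c ∧ Q.2 c = B.2 c) ∧ ¬ (R.1 c = B.1 c ∧ R.2 c = B.2 c) ∧ ¬ (P.1 c = B.1 c ∧ P.2 c = B.2 c)) :=
    fun c hc => H c ⟨hc.2.2, hc.1, hc.2.1⟩
  have HR : ∀ c, ¬ (¬ (R.1 c = B.1 c ∧ R.2 c = B.2 c) ∧ ¬ (P.1 c = B.1 c ∧ P.2 c = B.2 c) ∧ ¬ (Q.1 c = B.1 c ∧ Q.2 c = B.2 c)) :=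
    fun c hc => H c ⟨hc.2.1, hc.2.2, hc.1⟩
  -- from `H`: two deviations exclude the third
  have exR : ∀ {c}, ¬ (P.1 c = B.1 c ∧ P.2 c = B.2 c) → ¬ (Q.1 c = B.1 c ∧ Q.2 c = B.2 c) → (R.1 c = B.1 c ∧ R.2 c = B.2 c) :=
    fun h1 h2 => by by_contra h3; exact H _ ⟨h1, h2, h3⟩
  have exP : ∀ {c}, ¬ (Q.1 c = B.1 c ∧ Q.2 c = B.2 c) → ¬ (R.1 c = B.1 c ∧ R.2 c = B.2 c) → (P.1 c = B.1 c ∧ P.2 c = B.2 c) :=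
    fun h1 h2 => by by_contra h3; exact H _ ⟨h3, h1, h2⟩
  have exQ : ∀ {c}, ¬ (R.1 c = B.1 c ∧ R.2 c = B.2 c) → ¬ (P.1 c = B.1 c ∧ P.2 c = B.2 c) → (Q.1 c = B.1 c ∧ Q.2 c = B.2 c) :=
    fun h1 h2 => by by_contra h3; exact H _ ⟨h2, h3, h1⟩
  -- the three triple columns
  obtain ⟨cPQ, hPQ_P, hPQ_Q, hPQ_ne⟩ := exists_triple d v ε hB hP hQ hR eP eQ eR hcP hcQ hcR hδP hδQ hδR H
  obtain ⟨cQR, hQR_Q, hQR_R, hQR_ne⟩ := exists_triple d v ε hB hQ hR hP eQ eR eP hcQ hcR hcP hδQ hδR hδP HQ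
  obtain ⟨cRP, hRP_R, hRP_P, hRP_ne⟩ := exists_triple d v ε hB hR hP hQ eR eP eQ hcR hcP hcQ hδR hδP hδQ HR
  -- the entry columns: first hits `cRP ⇝ uQ` along `P`, `uQ ⇝ uR` along `Q`, `uR ⇝ uP` along `R`, and `uP ⇝ uQ` along `P` again
  obtain ⟨n₁, -, -, hn₁dev, -, hn₁entry⟩ :=
    first_hit d v ε hB hP eP hcP hδP (Q := Q) (u := cRP) (c₀ := cPQ) hRP_P (exQ hRP_R hRP_P) hPQ_P hPQ_Q
  set uQ : Fin m := ((B.1⁻¹ * P.1) ^ n₁) cRP with huQdef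
  have huQ_P : ¬ (P.1 uQ = B.1 uQ ∧ P.2 uQ = B.2 uQ) := coord_dev hRP_P n₁
  have huQ_Q : ¬ (Q.1 uQ = B.1 uQ ∧ Q.2 uQ = B.2 uQ) := hn₁dev
  have huQ_R : R.1 uQ = B.1 uQ ∧ R.2 uQ = B.2 uQ := exR huQ_P huQ_Q
  clear_value uQ
  obtain ⟨nQ, hnQpos, hnQlt, hnQdev, hnQmin, hnQentry⟩ :=
    first_hit d v ε hB hQ eQ hcQ hδQ (Q := R) (u := uQ) (c₀ := cQR) huQ_Q huQ_R hQR_Q hQR_R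
  set uR : Fin m := ((B.1⁻¹ * Q.1) ^ nQ) uQ with huRdef
  have huR_Q : ¬ (Q.1 uR = B.1 uR ∧ Q.2 uR = B.2 uR) := by rw [huRdef]; exact coord_dev huQ_Q nQ
  have huR_R : ¬ (R.1 uR = B.1 uR ∧ R.2 uR = B.2 uR) := by rw [huRdef]; exact hnQdev
  have huR_P : P.1 uR = B.1 uR ∧ P.2 uR = B.2 uR := exP huR_Q huR_R
  obtain ⟨nR, hnRpos, hnRlt, hnRdev, hnRmin, hnRentry⟩ :=
    first_hit d v ε hB hR eR hcR hδR (Q := P) (u := uR) (c₀ := cRP) huR_R huR_P hRP_R hRP_P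
  set uP : Fin m := ((B.1⁻¹ * R.1) ^ nR) uR with huPdef
  have huP_R : ¬ (R.1 uP = B.1 uP ∧ R.2 uP = B.2 uP) := by rw [huPdef]; exact coord_dev huR_R nR
  have huP_P : ¬ (P.1 uP = B.1 uP ∧ P.2 uP = B.2 uP) := by rw [huPdef]; exact hnRdev
  have huP_Q : Q.1 uP = B.1 uP ∧ Q.2 uP = B.2 uP := exQ huP_R huP_P
  obtain ⟨nP, hnPpos, hnPlt, hnPdev, hnPmin, hnPentry⟩ :=
    first_hit d v ε hB hP eP hcP hδP (Q := Q) (u := uP) (c₀ := cPQ) huP_P huP_Q hPQ_P hPQ_Q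
  have hclose : ((B.1⁻¹ * P.1) ^ nP) uP = uQ :=
    entry_unique d v ε hB hP hQ eP eQ hcP hcQ hδP hδQ (coord_dev huP_P nP) hnPdev huQ_P huQ_Q hnPentry hn₁entry
  -- the complementary runs avoid the contacts
  have tailP := tail_avoids d v ε hB hP hR eP eR hcP hcR hδP hδR huP_P huP_R (entry_symm hnRentry) hnPpos
    (by rw [hclose]; exact huQ_R)
  have tailQ := tail_avoids d v ε hB hQ hP eQ eP hcQ hcP hδQ hδP huQ_Q huQ_P (entry_symm hn₁entry) hnQpos
    (show P.1 uR = B.1 uR ∧ P.2 uR = B.2 uR from huR_P)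
  have tailR := tail_avoids d v ε hB hR hQ eR eQ hcR hcQ hδR hδQ huR_R huR_Q (entry_symm hnQentry) hnRpos
    (show Q.1 uP = B.1 uP ∧ Q.2 uP = B.2 uP from huP_Q)
  -- coordinates on the three cycles
  set NP : ℕ := Function.minimalPeriod (B.1⁻¹ * P.1) uP with hNP
  set NQ : ℕ := Function.minimalPeriod (B.1⁻¹ * Q.1) uQ with hNQ
  set NR : ℕ := Function.minimalPeriod (B.1⁻¹ * R.1) uR with hNR
  set colP : ℕ → Fin m := fun t => ((B.1⁻¹ * P.1) ^ t) uP with hcolP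
  set colQ : ℕ → Fin m := fun t => ((B.1⁻¹ * Q.1) ^ t) uQ with hcolQ
  set colR : ℕ → Fin m := fun t => ((B.1⁻¹ * R.1) ^ t) uR with hcolR
  have cP0 : colP 0 = uP := by simp [hcolP]
  have cQ0 : colQ 0 = uQ := by simp [hcolQ]
  have cR0 : colR 0 = uR := by simp [hcolR]
  have cPn : colP nP = uQ := by simp only [hcolP]; exact hclose
  have cQn : colQ nQ = uR := by simp only [hcolQ]; exact huRdef.symm
  have cRn : colR nR = uP := by simp only [hcolR]; exact huPdef.symm
  have cPN : colP NP = uP := by simp only [hcolP]; exact pow_minimalPeriod_apply _ uP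
  have cQN : colQ NQ = uQ := by simp only [hcolQ]; exact pow_minimalPeriod_apply _ uQ
  have cRN : colR NR = uR := by simp only [hcolR]; exact pow_minimalPeriod_apply _ uR
  have sP : ∀ t, B.1.symm (P.1 (colP t)) = colP (t + 1) := fun t => by simp only [hcolP]; rw [pow_succ_apply]; rfl
  have sQ : ∀ t, B.1.symm (Q.1 (colQ t)) = colQ (t + 1) := fun t => by simp only [hcolQ]; rw [pow_succ_apply]; rfl
  have sR : ∀ t, B.1.symm (R.1 (colR t)) = colR (t + 1) := fun t => by simp only [hcolR]; rw [pow_succ_apply]; rfl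
  have iP : ∀ t t', t < NP → t' < NP → colP t = colP t' → t = t' := fun t t' ht ht' h => pow_apply_injOn _ uP ht ht' h
  have iQ : ∀ t t', t < NQ → t' < NQ → colQ t = colQ t' → t = t' := fun t t' ht ht' h => pow_apply_injOn _ uQ ht ht' h
  have iR : ∀ t t', t < NR → t' < NR → colR t = colR t' → t = t' := fun t t' ht ht' h => pow_apply_injOn _ uR ht ht' h
  have dP : ∀ t, ¬ (P.1 (colP t) = B.1 (colP t) ∧ P.2 (colP t) = B.2 (colP t)) := fun t => by simp only [hcolP]; exact coord_dev huP_P t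
  have dQ : ∀ t, ¬ (Q.1 (colQ t) = B.1 (colQ t) ∧ Q.2 (colQ t) = B.2 (colQ t)) := fun t => by simp only [hcolQ]; exact coord_dev huQ_Q t
  have dR : ∀ t, ¬ (R.1 (colR t) = B.1 (colR t) ∧ R.2 (colR t) = B.2 (colR t)) := fun t => by simp only [hcolR]; exact coord_dev huR_R t
  -- avoidance: the first runs (`first_hit`) and the tails (`tail_avoids`)
  have aPQ : ∀ t, t < nP → Q.1 (colP t) = B.1 (colP t) ∧ Q.2 (colP t) = B.2 (colP t) := fun t ht => by simp only [hcolP]; exact hnPmin t ht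
  have aQR : ∀ t, t < nQ → R.1 (colQ t) = B.1 (colQ t) ∧ R.2 (colQ t) = B.2 (colQ t) := fun t ht => by simp only [hcolQ]; exact hnQmin t ht
  have aRP : ∀ t, t < nR → P.1 (colR t) = B.1 (colR t) ∧ P.2 (colR t) = B.2 (colR t) := fun t ht => by simp only [hcolR]; exact hnRmin t ht
  have bPR : ∀ t, nP ≤ t → t < NP → R.1 (colP t) = B.1 (colP t) ∧ R.2 (colP t) = B.2 (colP t) := fun t h1 h2 => by
    simp only [hcolP]; exact tailP t h1 h2
  have bQP : ∀ t, nQ ≤ t → t < NQ → P.1 (colQ t) = B.1 (colQ t) ∧ P.2 (colQ t) = B.2 (colQ t) := fun t h1 h2 => by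
    simp only [hcolQ]; exact tailQ t h1 h2
  have bRQ : ∀ t, nR ≤ t → t < NR → Q.1 (colR t) = B.1 (colR t) ∧ Q.2 (colR t) = B.2 (colR t) := fun t h1 h2 => by
    simp only [hcolR]; exact tailR t h1 h2
  -- totals
  have totP := cycle_total d v ε hB hP eP hcP hδP huP_P
  have totQ := cycle_total d v ε hB hQ eQ hcQ hδQ huQ_Q
  have totR := cycle_total d v ε hB hR eR hcR hδR huR_R
  simp only [← hcolP, ← hNP] at totP
  simp only [← hcolQ, ← hNQ] at totQ
  simp only [← hcolR, ← hNR] at totR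
  clear_value colP colQ colR NP NQ NR
  have hNPpos : 0 < NP := by omega
  have hNQpos : 0 < NQ := by omega
  have hNRpos : 0 < NR := by omega
  -- the docking data: runs as images of coordinate intervals
  have memI : ∀ (col : ℕ → Fin m) (lo hi : ℕ) (i : Fin m), i ∈ (Finset.Ico lo hi).image col ↔ ∃ t, lo ≤ t ∧ t < hi ∧ col t = i := by
    intro col lo hi i
    simp only [mem_image, mem_Ico]
    exact ⟨fun ⟨t, ⟨h1, h2⟩, h3⟩ => ⟨t, h1, h2, h3⟩, fun ⟨t, h1, h2, h3⟩ => ⟨t, ⟨h1, h2⟩, h3⟩⟩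
  -- generic run facts: interior steps and the exit
  have runIn : ∀ (X : Equiv.Perm (Fin m) × (Fin m → Fin K)) (col : ℕ → Fin m) (N lo up : ℕ),
      (∀ t, B.1.symm (X.1 (col t)) = col (t + 1)) → (∀ t t', t < N → t' < N → col t = col t' → t = t') → lo < up → up ≤ N →
      ∀ i ∈ (Finset.Ico lo up).image col, i ≠ col (up - 1) → B.1.symm (X.1 i) ∈ (Finset.Ico lo up).image col ∧ B.1.symm (X.1 i) ≠ col lo := by
    intro X col N lo up hs hinj hlo hup i hmem hix
    obtain ⟨t, ht1, ht2, rfl⟩ := (memI col lo up i).1 hmem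
    have ht3 : t + 1 < up := by
      by_contra h
      exact hix (by congr 1; omega)
    rw [hs]
    refine ⟨(memI col lo up _).2 ⟨t + 1, by omega, ht3, rfl⟩, fun h => ?_⟩
    have := hinj (t + 1) lo (by omega) (by omega) h
    omega
  -- disjointness from avoidance
  have disj : ∀ (colX colY : ℕ → Fin m) (loX upX loY upY : ℕ) (devY : Fin m → Prop),
      (∀ t, loX ≤ t → t < upX → ¬ devY (colX t)) → (∀ t, devY (colY t)) →
      Disjoint ((Finset.Ico loX upX).image colX) ((Finset.Ico loY upY).image colY) := by
    intro colX colY loX upX loY upY devY havoid hdev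
    rw [Finset.disjoint_left]
    intro i hmX hmY
    obtain ⟨t, ht1, ht2, rfl⟩ := (memI colX loX upX i).1 hmX
    obtain ⟨s, -, -, hs⟩ := (memI colY loY upY _).1 hmY
    exact havoid t ht1 ht2 (hs ▸ hdev s)
  -- ω : runs `[0, n)` docked `P → Q → R → P`
  let P3 : Fin 3 → Equiv.Perm (Fin m) × (Fin m → Fin K) := ![P, Q, R]
  let θ3 : Fin 3 → ℤ := ![θP, θQ, θR]
  let e3 : Fin 3 → Fin m := ![eP, eQ, eR]
  have hP3 : ∀ j, IsDominant d v ε (θ3 j) (P3 j) := by intro j; fin_cases j <;> assumption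
  have hc3 : ∀ j i, i ≠ e3 j → d ((P3 j).2 i) = d (B.2 i) := by intro j; fin_cases j <;> assumption
  have hδ3 : ∀ j, d (B.2 (e3 j)) < d ((P3 j).2 (e3 j)) := by intro j; fin_cases j <;> assumption
  have hr0 : finRotate 3 0 = 1 := by decide
  have hr1 : finRotate 3 1 = 2 := by decide
  have hr2 : finRotate 3 2 = 0 := by decide
  have hr0' : (finRotate 3).symm 0 = 2 := by decide
  have hr1' : (finRotate 3).symm 1 = 0 := by decide
  have hr2' : (finRotate 3).symm 2 = 1 := by decide
  let A : Fin 3 → Finset (Fin m) := ![(Finset.Ico 0 nP).image colP, (Finset.Ico 0 nQ).image colQ, (Finset.Ico 0 nR).image colR]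
  let A' : Fin 3 → Finset (Fin m) := ![(Finset.Ico nP NP).image colP, (Finset.Ico nQ NQ).image colQ, (Finset.Ico nR NR).image colR]
  -- avoidance in `dev` form
  have aPQ' : ∀ t, 0 ≤ t → t < nP → ¬ ¬ (Q.1 (colP t) = B.1 (colP t) ∧ Q.2 (colP t) = B.2 (colP t)) := fun t _ ht h => h (aPQ t ht)
  have aQR' : ∀ t, 0 ≤ t → t < nQ → ¬ ¬ (R.1 (colQ t) = B.1 (colQ t) ∧ R.2 (colQ t) = B.2 (colQ t)) := fun t _ ht h => h (aQR t ht)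
  have aRP' : ∀ t, 0 ≤ t → t < nR → ¬ ¬ (P.1 (colR t) = B.1 (colR t) ∧ P.2 (colR t) = B.2 (colR t)) := fun t _ ht h => h (aRP t ht)
  have bPR' : ∀ t, nP ≤ t → t < NP → ¬ ¬ (R.1 (colP t) = B.1 (colP t) ∧ R.2 (colP t) = B.2 (colP t)) := fun t h1 h2 h => h (bPR t h1 h2)
  have bQP' : ∀ t, nQ ≤ t → t < NQ → ¬ ¬ (P.1 (colQ t) = B.1 (colQ t) ∧ P.2 (colQ t) = B.2 (colQ t)) := fun t h1 h2 h => h (bQP t h1 h2)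
  have bRQ' : ∀ t, nR ≤ t → t < NR → ¬ ¬ (Q.1 (colR t) = B.1 (colR t) ∧ Q.2 (colR t) = B.2 (colR t)) := fun t h1 h2 h => h (bRQ t h1 h2)
  have dAPQ := disj colP colQ 0 nP 0 nQ (fun i => ¬ (Q.1 i = B.1 i ∧ Q.2 i = B.2 i)) aPQ' dQ
  have dAQR := disj colQ colR 0 nQ 0 nR (fun i => ¬ (R.1 i = B.1 i ∧ R.2 i = B.2 i)) aQR' dR
  have dARP := disj colR colP 0 nR 0 nP (fun i => ¬ (P.1 i = B.1 i ∧ P.2 i = B.2 i)) aRP' dP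
  have dA'PR := disj colP colR nP NP nR NR (fun i => ¬ (R.1 i = B.1 i ∧ R.2 i = B.2 i)) bPR' dR
  have dA'QP := disj colQ colP nQ NQ nP NP (fun i => ¬ (P.1 i = B.1 i ∧ P.2 i = B.2 i)) bQP' dP
  have dA'RQ := disj colR colQ nR NR nQ NQ (fun i => ¬ (Q.1 i = B.1 i ∧ Q.2 i = B.2 i)) bRQ' dQ
  have ineq₁ := multiRun_deficit d v ε θ3 P3 hB hP3 e3 hc3 hδ3 A
    ![colP (nP - 1), colQ (nQ - 1), colR (nR - 1)] ![colP 0, colQ 0, colR 0] (finRotate 3)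
    (by
      intro j k hjk
      fin_cases j <;> fin_cases k
      · exact absurd rfl hjk
      · exact dAPQ
      · exact dARP.symm
      · exact dAPQ.symm
      · exact absurd rfl hjk
      · exact dAQR
      · exact dARP
      · exact dAQR.symm
      · exact absurd rfl hjk)
    (by
      intro j; fin_cases j
      · exact (memI colP 0 nP _).2 ⟨0, le_rfl, hnPpos, rfl⟩
      · exact (memI colQ 0 nQ _).2 ⟨0, le_rfl, hnQpos, rfl⟩
      · exact (memI colR 0 nR _).2 ⟨0, le_rfl, hnRpos, rfl⟩)
    (by
      intro j; fin_cases j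
      · exact runIn P colP NP 0 nP sP iP hnPpos hnPlt.le
      · exact runIn Q colQ NQ 0 nQ sQ iQ hnQpos hnQlt.le
      · exact runIn R colR NR 0 nR sR iR hnRpos hnRlt.le)
    (by
      intro j; fin_cases j
      · show B.1.symm (P.1 (colP (nP - 1))) = ![colP 0, colQ 0, colR 0] (finRotate 3 0)
        rw [hr0, sP, cQ0, ← cPn]; congr 1; omega
      · show B.1.symm (Q.1 (colQ (nQ - 1))) = ![colP 0, colQ 0, colR 0] (finRotate 3 1)
        rw [hr1, sQ, cR0, ← cQn]; congr 1; omega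
      · show B.1.symm (R.1 (colR (nR - 1))) = ![colP 0, colQ 0, colR 0] (finRotate 3 2)
        rw [hr2, sR, cP0, ← cRn]; congr 1; omega)
    (by
      intro j; fin_cases j
      · intro i hi; obtain ⟨t, -, -, rfl⟩ := (memI colP 0 nP i).1 hi; exact dP t
      · intro i hi; obtain ⟨t, -, -, rfl⟩ := (memI colQ 0 nQ i).1 hi; exact dQ t
      · intro i hi; obtain ⟨t, -, -, rfl⟩ := (memI colR 0 nR i).1 hi; exact dR t)
    (by
      intro j; fin_cases j
      · -- witness `cPQ` for `P`: off the `P`-run (which avoids `Q`), deviating in `P`, differing from `Q` there, not on the `R`-run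
        refine ⟨cPQ, fun h => ?_, hPQ_P, fun k hk => ?_⟩
        · obtain ⟨t, ht1, ht2, hct⟩ := (memI colP 0 nP _).1 h
          exact hPQ_Q (hct ▸ aPQ t ht2)
        · fin_cases k
          · exact absurd hk (fun h => by
              obtain ⟨t, ht1, ht2, hct⟩ := (memI colP 0 nP _).1 h
              exact hPQ_Q (hct ▸ aPQ t ht2))
          · exact fun hh => hPQ_ne ⟨hh.1.symm, hh.2.symm⟩
          · obtain ⟨t, -, -, hct⟩ := (memI colR 0 nR _).1 hk
            exact absurd (hct ▸ dR t) (fun h => h (exR hPQ_P hPQ_Q))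
      · refine ⟨cQR, fun h => ?_, hQR_Q, fun k hk => ?_⟩
        · obtain ⟨t, ht1, ht2, hct⟩ := (memI colQ 0 nQ _).1 h
          exact hQR_R (hct ▸ aQR t ht2)
        · fin_cases k
          · obtain ⟨t, -, -, hct⟩ := (memI colP 0 nP _).1 hk
            exact absurd (hct ▸ dP t) (fun h => h (exP hQR_Q hQR_R))
          · exact absurd hk (fun h => by
              obtain ⟨t, ht1, ht2, hct⟩ := (memI colQ 0 nQ _).1 h
              exact hQR_R (hct ▸ aQR t ht2))
          · exact fun hh => hQR_ne ⟨hh.1.symm, hh.2.symm⟩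
      · refine ⟨cRP, fun h => ?_, hRP_R, fun k hk => ?_⟩
        · obtain ⟨t, ht1, ht2, hct⟩ := (memI colR 0 nR _).1 h
          exact hRP_P (hct ▸ aRP t ht2)
        · fin_cases k
          · exact fun hh => hRP_ne ⟨hh.1.symm, hh.2.symm⟩
          · obtain ⟨t, -, -, hct⟩ := (memI colQ 0 nQ _).1 hk
            exact absurd (hct ▸ dQ t) (fun h => h (exQ hRP_R hRP_P))
          · exact absurd hk (fun h => by
              obtain ⟨t, ht1, ht2, hct⟩ := (memI colR 0 nR _).1 h
              exact hRP_P (hct ▸ aRP t ht2)))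
  -- ω̄ : the complementary runs `[n, N)` docked `P → R → Q → P`
  have ineq₂ := multiRun_deficit d v ε θ3 P3 hB hP3 e3 hc3 hδ3 A'
    ![colP (NP - 1), colQ (NQ - 1), colR (NR - 1)] ![colP nP, colQ nQ, colR nR] (finRotate 3).symm
    (by
      intro j k hjk
      fin_cases j <;> fin_cases k
      · exact absurd rfl hjk
      · exact dA'QP.symm
      · exact dA'PR
      · exact dA'QP
      · exact absurd rfl hjk
      · exact dA'RQ.symm
      · exact dA'PR.symm
      · exact dA'RQ
      · exact absurd rfl hjk)
    (by
      intro j; fin_cases j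
      · exact (memI colP nP NP _).2 ⟨nP, le_rfl, hnPlt, rfl⟩
      · exact (memI colQ nQ NQ _).2 ⟨nQ, le_rfl, hnQlt, rfl⟩
      · exact (memI colR nR NR _).2 ⟨nR, le_rfl, hnRlt, rfl⟩)
    (by
      intro j; fin_cases j
      · exact runIn P colP NP nP NP sP iP hnPlt le_rfl
      · exact runIn Q colQ NQ nQ NQ sQ iQ hnQlt le_rfl
      · exact runIn R colR NR nR NR sR iR hnRlt le_rfl)
    (by
      intro j; fin_cases j
      · show B.1.symm (P.1 (colP (NP - 1))) = ![colP nP, colQ nQ, colR nR] ((finRotate 3).symm 0)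
        rw [hr0', sP, cRn, ← cPN]; congr 1; omega
      · show B.1.symm (Q.1 (colQ (NQ - 1))) = ![colP nP, colQ nQ, colR nR] ((finRotate 3).symm 1)
        rw [hr1', sQ, cPn, ← cQN]; congr 1; omega
      · show B.1.symm (R.1 (colR (NR - 1))) = ![colP nP, colQ nQ, colR nR] ((finRotate 3).symm 2)
        rw [hr2', sR, cQn, ← cRN]; congr 1; omega)
    (by
      intro j; fin_cases j
      · intro i hi; obtain ⟨t, -, -, rfl⟩ := (memI colP nP NP i).1 hi; exact dP t
      · intro i hi; obtain ⟨t, -, -, rfl⟩ := (memI colQ nQ NQ i).1 hi; exact dQ t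
      · intro i hi; obtain ⟨t, -, -, rfl⟩ := (memI colR nR NR i).1 hi; exact dR t)
    (by
      intro j; fin_cases j
      · -- witness `cRP` for `P`: the tail of `P` avoids `R`
        refine ⟨cRP, fun h => ?_, hRP_P, fun k hk => ?_⟩
        · obtain ⟨t, ht1, ht2, hct⟩ := (memI colP nP NP _).1 h
          exact hRP_R (hct ▸ bPR t ht1 ht2)
        · fin_cases k
          · exact absurd hk (fun h => by
              obtain ⟨t, ht1, ht2, hct⟩ := (memI colP nP NP _).1 h
              exact hRP_R (hct ▸ bPR t ht1 ht2))
          · obtain ⟨t, -, -, hct⟩ := (memI colQ nQ NQ _).1 hk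
            exact absurd (hct ▸ dQ t) (fun h => h (exQ hRP_R hRP_P))
          · exact fun hh => hRP_ne hh
      · refine ⟨cPQ, fun h => ?_, hPQ_Q, fun k hk => ?_⟩
        · obtain ⟨t, ht1, ht2, hct⟩ := (memI colQ nQ NQ _).1 h
          exact hPQ_P (hct ▸ bQP t ht1 ht2)
        · fin_cases k
          · exact fun hh => hPQ_ne hh
          · exact absurd hk (fun h => by
              obtain ⟨t, ht1, ht2, hct⟩ := (memI colQ nQ NQ _).1 h
              exact hPQ_P (hct ▸ bQP t ht1 ht2))
          · obtain ⟨t, -, -, hct⟩ := (memI colR nR NR _).1 hk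
            exact absurd (hct ▸ dR t) (fun h => h (exR hPQ_P hPQ_Q))
      · refine ⟨cQR, fun h => ?_, hQR_R, fun k hk => ?_⟩
        · obtain ⟨t, ht1, ht2, hct⟩ := (memI colR nR NR _).1 h
          exact hQR_Q (hct ▸ bRQ t ht1 ht2)
        · fin_cases k
          · obtain ⟨t, -, -, hct⟩ := (memI colP nP NP _).1 hk
            exact absurd (hct ▸ dP t) (fun h => h (exP hQR_Q hQR_R))
          · exact fun hh => hQR_ne hh
          · exact absurd hk (fun h => by
              obtain ⟨t, ht1, ht2, hct⟩ := (memI colR nR NR _).1 h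
              exact hQR_Q (hct ▸ bRQ t ht1 ht2)))
  -- bookkeeping: both inequalities in terms of the three piece functionals
  have splitP := pieceFun_add colP NP iP (fun i => v (P.1 i) i (P.2 i) - v (B.1 i) i (B.2 i)) eP
    ((∑ i, v (P.1 i) i (P.2 i)) - ∑ i, v (B.1 i) i (B.2 i)) (Nat.zero_le nP) hnPlt.le le_rfl
  have splitQ := pieceFun_add colQ NQ iQ (fun i => v (Q.1 i) i (Q.2 i) - v (B.1 i) i (B.2 i)) eQ
    ((∑ i, v (Q.1 i) i (Q.2 i)) - ∑ i, v (B.1 i) i (B.2 i)) (Nat.zero_le nQ) hnQlt.le le_rfl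
  have splitR := pieceFun_add colR NR iR (fun i => v (R.1 i) i (R.2 i) - v (B.1 i) i (B.2 i)) eR
    ((∑ i, v (R.1 i) i (R.2 i)) - ∑ i, v (B.1 i) i (B.2 i)) (Nat.zero_le nR) hnRlt.le le_rfl
  beta_reduce at splitP splitQ splitR
  obtain ⟨totP1, totP2⟩ := totP
  obtain ⟨totQ1, totQ2⟩ := totQ
  obtain ⟨totR1, totR2⟩ := totR
  rw [if_pos totP2] at splitP
  rw [if_pos totQ2] at splitQ
  rw [if_pos totR2] at splitR
  rw [Finset.sum_filter, Fin.sum_univ_three, Fin.sum_univ_three] at ineq₁ ineq₂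
  simp only [P3, e3, A, A', Matrix.cons_val_zero, Matrix.cons_val_one, Matrix.cons_val_two, Matrix.head_cons,
    Matrix.tail_cons] at ineq₁ ineq₂
  linarith

end Three

end SingleContact

end Summit.ValiantsHypothesis.ValiantsHypothesis.Theorems.KPlusLogSqLaw
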